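import Literature.Barriers.FinalStateConjecture.ExtremalHorizonMultiplierIdentity
import Literature.Geometry.Lorentzian.KerrStarHorizonEnergyEstimate
import HarnessLib

/-!
# The near-horizon `N`-energy estimate for Aretakis's class on extremal Kerr
# (Aretakis 2012, §13.1 on `𝓐_N`, modulo the outer flux and the zeroth-order terms)

(family `gr`; proving seat of `Literature.Barriers.FinalStateConjecture.Aretakis2012_pointwiseDecay`
— Aretakis, JFA 263 (2012), Thm. 5. By `ExtremalHorizonPointwiseDecayFromEnergy.lean` the fact is
reduced to the uniform boundedness of the non-degenerate energy near `𝓗⁺` (Thm. 2 of the source)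
and integrated decay (Thm. 1); this file transfers the coordinate estimate
`Kerr.StarCoord.nEnergy_box_estimate` (`KerrStarHorizonEnergyEstimate.lean`) — Stokes for the
current `J^{N,−1/2}` on `[t₁, t₂] × 𝓐_N`, the bulk and the horizon flux signed by Prop. 7.2.1 — to
the class of solutions of the fact, exactly as `ExtremalHorizonMultiplierIdentity.lean` does for the
general multiplier identity.)

* `Kerr.nEnergy_estimate_of_class` (**the estimate**): for `Φ` smooth at the points of an open
  `U₀ ⊇ {r ≥ M, t* ≥ 0}` of the extremal Kerr region, axisymmetric, solving `□_g ψ = 0` on `U₀`, and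
  `0 ≤ t₁ ≤ t₂`, with `G = Φ ∘ κ`:
  `∫₀^π∫_M^{23M/21} e_low(t₂) + ∫_{t₁}^{t₂}∫₀^π∫_M^{23M/21} K_low
     ≤ ∫₀^π∫_M^{23M/21} E_N(t₁) + ∫_{t₁}^{t₂}∫₀^π F_N(t, 23M/21, θ) − ∫₀^π∫_M^{23M/21} Z(t₂)`
  (notation of `KerrStarHorizonEnergyEstimate.lean`). No far-field hypothesis is needed here: the
  box is the compact near-horizon region `𝓐_N`.

Everything is proved; no named facts.

## References

* S. Aretakis, *Decay of axisymmetric solutions of the wave equation on extreme Kerr backgrounds*,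
  J. Funct. Anal. 263 (2012) 2770–2831 (arXiv:1110.2006): §7.2 (Prop. 7.2.1), §13.1, Prop. 13.2.1
  (key `Aretakis2012`).
-/

noncomputable section

open Set Filter MeasureTheory intervalIntegral
open scoped Topology ContDiff Manifold

namespace Literature.Barriers.FinalStateConjecture.Kerr

open Literature.Geometry.Lorentzian
open Literature.Geometry.Lorentzian.Kerr.StarCoord

variable [Kerr.Facts] [Kerr.SliceFacts] {M r₀ : ℝ} {U₀ : Set (Kerr.region M r₀)} {Φ : E4 → ℝ}

/-- **The near-horizon `N`-energy estimate for Aretakis's class (§13.1 on `𝓐_N = {M ≤ r ≤ 23M/21}`).**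
For `Φ` smooth at the points of an open `U₀ ⊇ {r ≥ M, t* ≥ 0}` of the extremal Kerr region
(`a = M > 0`), invariant under the axial rotations (where `r_BL > 0`) and solving `□_g ψ = 0` on `U₀`,
and times `0 ≤ t₁ ≤ t₂`: with `G = Φ ∘ κ` (Kerr-star chart) and the current `J^{N,−1/2}`,
`∫∫ e_low(t₂) + ∫_{t₁}^{t₂}∫∫ K_low ≤ ∫∫ E_N(t₁) + ∫_{t₁}^{t₂}∫₀^π F_N(t, 23M/21, θ) dθ dt − ∫∫ Z(t₂)` —
`Kerr.StarCoord.nEnergy_box_estimate` applied on the coordinate neighbourhood of the box furnished by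
the class hypotheses (the separated equation off the axis from `separated_equations_starPull`).
[cite: Aretakis2012, §13.1 and Prop. 13.2.1] -/
theorem nEnergy_estimate_of_class (hM : 0 < M) (hr₀ : r₀ ∈ Set.Ioo 0 M) (hU₀ : IsOpen U₀)
    (hKU : {x : Kerr.region M r₀ | Kerr.rPlus M M ≤ Kerr.radius M (x : E4) ∧ 0 ≤ (x : E4) 0} ⊆ U₀)
    (hΦ : ∀ x ∈ U₀, ContDiffAt ℝ ∞ Φ x)
    (haxi : ∀ (β : ℝ) (z : E4), 0 < Kerr.radius M z → Φ (E4.axialRotation β z) = Φ z)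
    (hsol : ∀ x ∈ U₀, (Kerr.smoothMetric M M r₀).toPseudoRiemannianMetric.dalembertian
      (fun y : Kerr.region M r₀ ↦ Φ y) x = 0)
    {t₁ t₂ φ₀ : ℝ} (ht₁ : 0 ≤ t₁) (ht : t₁ ≤ t₂) :
    (∫ θ in (0 : ℝ)..Real.pi, ∫ r in M..(23 / 21 * M),
        nEnergyLower M (Kerr.starPull M Φ) (boxPoint φ₀ t₂ r θ)) +
        (∫ t in t₁..t₂, ∫ θ in (0 : ℝ)..Real.pi, ∫ r in M..(23 / 21 * M),
          nBulkLower M (Kerr.starPull M Φ) (boxPoint φ₀ t r θ)) ≤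
      (∫ θ in (0 : ℝ)..Real.pi, ∫ r in M..(23 / 21 * M),
          -multDensity M M (nProfileR M) (nProfileT M) nProfileW (Kerr.starPull M Φ) (boxPoint φ₀ t₁ r θ)) +
        (∫ t in t₁..t₂, ∫ θ in (0 : ℝ)..Real.pi,
          multFluxR M M (nProfileR M) (nProfileT M) nProfileW (Kerr.starPull M Φ)
            (boxPoint φ₀ t (23 / 21 * M) θ)) -
        ∫ θ in (0 : ℝ)..Real.pi, ∫ r in M..(23 / 21 * M),
          nEnergyZeroth M (Kerr.starPull M Φ) (boxPoint φ₀ t₂ r θ) := by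
  obtain ⟨hr₀pos, hr₀M⟩ := hr₀
  -- the coordinate open set and the separated equation off the axis
  set V : Set E4 := Subtype.val '' U₀ with hVdef
  have hV : IsOpen V := (Kerr.region M r₀).isOpen.isOpenMap_subtype_val U₀ hU₀
  have hΦV : ∀ z ∈ V, ContDiffAt ℝ ∞ Φ z := by
    rintro _ ⟨y, hyU, rfl⟩; exact hΦ y hyU
  set W₀ : Set E4 := {q : E4 | 0 < q 1 ∧ Kerr.starChart M q ∈ V} with hW₀def
  have hW₀ : IsOpen W₀ := (isOpen_lt continuous_const (PiLp.continuous_apply 2 _ 1)).inter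
    (hV.preimage (Kerr.contDiff_starChart M (n := 0)).continuous)
  have hG : ContDiffOn ℝ ∞ (Kerr.starPull M Φ) W₀ := fun q hq ↦
    (Kerr.contDiffAt_comp_starChart (hΦV _ hq.2)).contDiffWithinAt
  obtain ⟨-, -, -, hsep, -⟩ := separated_equations_starPull hU₀ hΦ haxi hsol
  have hP : ∀ q ∈ W₀, Real.sin (q 2) ≠ 0 →
      radOp M M (Kerr.starPull M Φ) q + angOp M (Kerr.starPull M Φ) q = 0 :=
    fun q hq hs ↦ hsep q ⟨hq.1, hs, hq.2⟩
  -- the box lies in `W₀`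
  have hK'reg : ∀ x : E4, Kerr.rPlus M M ≤ Kerr.radius M x ∧ 0 ≤ x 0 → x ∈ Kerr.region M r₀ := by
    intro x hx
    rw [Kerr.mem_region]
    have h1 := hx.1
    rw [Kerr.rPlus_self] at h1
    exact max_lt (by linarith) (by linarith)
  have hbox : ∀ t ∈ Icc t₁ t₂, ∀ r ∈ Icc M (23 / 21 * M), ∀ θ ∈ Icc 0 Real.pi, boxPoint φ₀ t r θ ∈ W₀ := by
    intro t ht' r hr' θ _
    have hK := shellPoint_mem_horizonFutureSet hM (ht₁.trans ht'.1) hr'.1 θ φ₀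
    refine ⟨hM.trans_le hr'.1, ?_⟩
    rw [starChart_boxPoint]
    exact ⟨⟨_, hK'reg _ hK⟩, hKU hK, rfl⟩
  exact nEnergy_box_estimate hM hW₀ hG hP ht hbox

end Literature.Barriers.FinalStateConjecture.Kerr

end
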